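import Summits.Ventures.LatticeQCDFlow.Scaling.HubCollectorLaw
import Summits.Ventures.LatticeQCDFlow.Scaling.FlowSamplerTunnelingTime

/-!
HONEST FRAMING: exact (Metropolis-corrected) sampling algorithms for lattice gauge theory; figures
of merit are autocorrelation/cost numbers at stated couplings and volumes; no continuum-physics
claim.

# SectorRefreshBudgetFloor — THE REFRESH BUDGET FOR FLOW-ASSISTED EXCHANGE: WHEN EVERY TRANSPORT `φ_r` PRESERVES A
# SECTOR `A` (`φ_r u ∈ A ↔ u ∈ A`), A MAP-ASSISTED SWAP ON ANY SWAP LIST KEEPS THE NUMBER OF REPLICAS IN `A`, SO FROM A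
# CONFIGURATION WITH EVERY REPLICA IN `A`: `d(n) ≥ 1 − n(1−t)/(K+1) − Σ_k μ_k(A)` AND
# `t_mix(ε) ≥ (K+1)(1 − ε − Σ_k μ_k(A))/(1−t)` — THE `1/(1−t)` FLOOR SURVIVES EVERY FAMILY OF MAPS THAT PRESERVES `A`
# (A HYPOTHESIS ON THE MAPS, NOT A PROPERTY OF FLOWS IN GENERAL) (lean-2 GEN-26, ours)

Venture-side (OURS).  Cell `lqcd-flow` (pub-lqcd), unit `pub-lqcd-lean-2-g26`, 2026-08-27.  Chapter M, file 22 — the sector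
form of `Scaling/RefreshBudgetFloor` (which is the case `A = {s}`, identity maps).  THE SCHEME: `P = t·GSw + (1−t)·Π_w^M`
on `Fin (K+1) → S`, Metropolis graph swap of an arbitrary swap list `e` (distinct endpoints) with bijections `φ_r` that
PRESERVE the set `A ⊆ S`, arbitrary update weights `w`, row-stochastic update kernels, positive laws.  The potential is
`N_A(z) = #{k : z_k ∈ A}`: a map-assisted swap replaces `(z_i, z_l)` by `(φ_r⁻¹ z_l, φ_r z_i)`, which permutes the
membership pattern; an update changes one coordinate.

## What is proved

* §1 `edgeFlowSwap_apply_cases`, **`sectorCount_edgeFlowSwap`** (`N_A` is invariant under an `A`-preserving edge swap),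
  **`sectorCount_update_ge`** (`N_A(z[j ↦ v]) ≥ N_A(z) − 1`).
* §2 **`entrySwap_sectorCount_eq`**, **`graphSwap_sectorCount_eq`** (`Σ_z GSw(y,z)N_A(z) = N_A(y)`),
  **`prodKernel_sectorCount_ge`**, **`scheme_sectorCount_ge`** (`Σ_z P(y,z)N_A(z) ≥ N_A(y) − (1−t)`),
  **`scheme_lawAt_sectorCount_ge`** (`E_x[N_A(X_n)] ≥ N_A(x) − n(1−t)`).
* §3 **`tensorFun_mass_someInSector_le`** (`π̃(∃ k, z_k ∈ A) ≤ Σ_k μ_k(A)`), **`sectorBudget_worstTvDist_ge`** — from any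
  `x` with all `x_k ∈ A`: **`d(n) ≥ 1 − n(1−t)/(K+1) − Σ_k μ_k(A)`**; **`sectorBudget_mixingTime_ge`** — `t < 1`,
  reversible updates, `ε`-close at some time: **`t_mix(ε) ≥ (K+1)(1 − ε − Σ_k μ_k(A))/(1−t)`**.

Reading (no numerics implied): IF every transport preserves a set `A` that is rare at every level
(`Σ_k μ_k(A) ≤ δ`) — `hφA` is a GENUINE hypothesis on the maps, not a consequence of their being continuous or
flow-generated (on a finite lattice the field space is connected and a lattice topological charge is no homotopy
invariant, so continuity of a map implies nothing about sector preservation; correction of record, LEAD LINE 571 (4),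
2026-08-27) — then a run started inside `A` cannot equilibrate before `(K+1)(1−ε−δ)` single-replica updates have
fired, i.e. `(K+1)(1−ε−δ)/(1−t)` steps, whatever the swap graph, the allocation or the quality of the maps; only the
updates (or maps that do move mass across `∂A`) tunnel.  NOT CLAIMED: that realistic flows satisfy `hφA`; maps that
change the sector (then the count is not invariant and the bound is void, as it should be); the logarithmic factor;
anything measured.  Literature grade (cell rule): OWN RESULT; nothing cited as a fact; no new bib keys.
-/

noncomputable section

open Finset Function
open Literature.Probability.MarkovChains

namespace Summit.Ventures.LatticeQCDFlow.Scaling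

variable {S : Type*} [Fintype S] [DecidableEq S] {K m : ℕ} {μ : Fin (K + 1) → S → ℝ} {M : Fin (K + 1) → S → S → ℝ}
  {w : Fin (K + 1) → ℝ} {t : ℝ} {e : Fin m → Fin (K + 1) × Fin (K + 1)} {φ : Fin m → Equiv.Perm S} {A : Finset S}

section Sector

/-! ## §1 The sector count `N_A(z) = #{k : z_k ∈ A}` -/

omit [Fintype S] [DecidableEq S] in
/-- The coordinates of an edge swap: `(swap z)_l = φ(z_i)`, `(swap z)_i = φ⁻¹(z_l)` (`i ≠ l`), others unchanged. [ours] -/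
theorem edgeFlowSwap_apply_cases (ψ : Equiv.Perm S) {i l : Fin (K + 1)} (hil : i ≠ l) (z : Fin (K + 1) → S)
    (k : Fin (K + 1)) :
    edgeFlowSwap ψ i l z k = if k = l then ψ (z i) else if k = i then ψ.symm (z l) else z k := by
  by_cases hkl : k = l
  · subst hkl; rw [if_pos rfl, edgeFlowSwap_snd]
  · rw [if_neg hkl]
    by_cases hki : k = i
    · subst hki; rw [if_pos rfl, edgeFlowSwap_fst ψ hil]
    · rw [if_neg hki]; unfold edgeFlowSwap; rw [update_of_ne hkl, update_of_ne hki]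

omit [Fintype S] in
/-- **The sector count is invariant under an `A`-preserving edge swap:** `N_A(swap_{il}^ψ z) = N_A(z)` when
`ψ u ∈ A ↔ u ∈ A`. [ours] -/
theorem sectorCount_edgeFlowSwap (ψ : Equiv.Perm S) (hψ : ∀ u, ψ u ∈ A ↔ u ∈ A) {i l : Fin (K + 1)} (hil : i ≠ l)
    (z : Fin (K + 1) → S) :
    ∑ k, (if edgeFlowSwap ψ i l z k ∈ A then (1 : ℝ) else 0) = ∑ k, (if z k ∈ A then (1 : ℝ) else 0) := by
  have hψ' : ∀ u, ψ.symm u ∈ A ↔ u ∈ A := fun u => by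
    have h := hψ (ψ.symm u); rw [Equiv.apply_symm_apply] at h; exact h.symm
  have hpt : ∀ k, (edgeFlowSwap ψ i l z k ∈ A) ↔ (z (Equiv.swap i l k) ∈ A) := by
    intro k
    rw [edgeFlowSwap_apply_cases ψ hil z k]
    by_cases hkl : k = l
    · subst hkl; rw [if_pos rfl, Equiv.swap_apply_right]; exact hψ _
    · rw [if_neg hkl]
      by_cases hki : k = i
      · subst hki; rw [if_pos rfl, Equiv.swap_apply_left]; exact hψ' _
      · rw [if_neg hki, Equiv.swap_apply_of_ne_of_ne hki hkl]
  have hcongr : ∀ k, (if edgeFlowSwap ψ i l z k ∈ A then (1 : ℝ) else 0) = (if z (Equiv.swap i l k) ∈ A then (1 : ℝ) else 0) :=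
    fun k => if_congr (hpt k) rfl rfl
  simp_rw [hcongr]
  exact Equiv.sum_comp (Equiv.swap i l) (fun k => if z k ∈ A then (1 : ℝ) else 0)

omit [Fintype S] in
/-- **A single-coordinate update costs at most one:** `N_A(z[j ↦ v]) ≥ N_A(z) − 1`. [ours] -/
theorem sectorCount_update_ge (z : Fin (K + 1) → S) (j : Fin (K + 1)) (v : S) :
    ∑ k, (if z k ∈ A then (1 : ℝ) else 0) - 1 ≤ ∑ k, (if update z j v k ∈ A then (1 : ℝ) else 0) := by
  have hj : ∑ k : Fin (K + 1), (if k = j then (1 : ℝ) else 0) = 1 := by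
    rw [Finset.sum_ite_eq' univ j, if_pos (mem_univ _)]
  have hsplit : (∑ k, (if z k ∈ A then (1 : ℝ) else 0)) - 1
      = ∑ k, ((if z k ∈ A then (1 : ℝ) else 0) - (if k = j then (1 : ℝ) else 0)) := by
    rw [Finset.sum_sub_distrib, hj]
  rw [hsplit]
  refine Finset.sum_le_sum fun k _ => ?_
  by_cases hk : k = j
  · subst hk
    rw [if_pos rfl]
    have h1 : (if z k ∈ A then (1 : ℝ) else 0) ≤ 1 := by split_ifs <;> norm_num
    have h2 : (0 : ℝ) ≤ (if update z k v k ∈ A then (1 : ℝ) else 0) := by split_ifs <;> norm_num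
    linarith
  · rw [if_neg hk, update_of_ne hk, sub_zero]

/-! ## §2 The drift of the sector count -/

/-- **An `A`-preserving entry Metropolis swap preserves the sector count in mean:** `Σ_z Met_r(y,z)·N_A(z) = N_A(y)`. [ours] -/
theorem entrySwap_sectorCount_eq (hμ : ∀ k x, 0 < μ k x) (ψ : Equiv.Perm S) (hψ : ∀ u, ψ u ∈ A ↔ u ∈ A)
    {i l : Fin (K + 1)} (hil : i ≠ l) (y : Fin (K + 1) → S) :
    ∑ z, mhKernel (fun a b : Fin (K + 1) → S => if b = edgeFlowSwap ψ i l a then (1 : ℝ) else 0)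
        (tensorFun μ) y z * (∑ k, (if z k ∈ A then (1 : ℝ) else 0))
      = ∑ k, (if y k ∈ A then (1 : ℝ) else 0) := by
  have hπ := tensorFun_pos hμ
  have hb := entryProposal_basic (φ := fun _ : Fin 1 => ψ) (e := fun _ : Fin 1 => (i, l)) (fun _ => hil) 0
  have hrow : ∑ z, mhKernel (fun a b : Fin (K + 1) → S => if b = edgeFlowSwap ψ i l a then (1 : ℝ) else 0)
      (tensorFun μ) y z = 1 := (mhKernel_isRowStochastic hb.1 hb.2.1 hπ).2 y
  have hzero : ∑ z, mhKernel (fun a b : Fin (K + 1) → S => if b = edgeFlowSwap ψ i l a then (1 : ℝ) else 0)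
      (tensorFun μ) y z * ((∑ k, (if z k ∈ A then (1 : ℝ) else 0)) - ∑ k, (if y k ∈ A then (1 : ℝ) else 0)) = 0 := by
    refine Finset.sum_eq_zero fun z _ => ?_
    by_cases hzy : z = y
    · rw [hzy, sub_self, mul_zero]
    · rw [mhKernel_of_ne hzy]
      by_cases hzs : z = edgeFlowSwap ψ i l y
      · rw [hzs, sectorCount_edgeFlowSwap ψ hψ hil, sub_self, mul_zero]
      · have hle := mhRate_le (fun a b : Fin (K + 1) → S => if b = edgeFlowSwap ψ i l a then (1 : ℝ) else 0)
          (tensorFun μ) y z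
        have hge := mhRate_nonneg hb.1 hπ y z
        simp only [hzs, if_false] at hle
        rw [le_antisymm hle hge, zero_mul]
  calc ∑ z, mhKernel (fun a b : Fin (K + 1) → S => if b = edgeFlowSwap ψ i l a then (1 : ℝ) else 0)
        (tensorFun μ) y z * (∑ k, (if z k ∈ A then (1 : ℝ) else 0))
      = ∑ z, (mhKernel (fun a b : Fin (K + 1) → S => if b = edgeFlowSwap ψ i l a then (1 : ℝ) else 0)
          (tensorFun μ) y z * ((∑ k, (if z k ∈ A then (1 : ℝ) else 0)) - ∑ k, (if y k ∈ A then (1 : ℝ) else 0))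
        + mhKernel (fun a b : Fin (K + 1) → S => if b = edgeFlowSwap ψ i l a then (1 : ℝ) else 0)
          (tensorFun μ) y z * ∑ k, (if y k ∈ A then (1 : ℝ) else 0)) := sum_congr rfl fun z _ => by ring
    _ = ∑ k, (if y k ∈ A then (1 : ℝ) else 0) := by
        rw [Finset.sum_add_distrib, hzero, ← Finset.sum_mul, hrow, zero_add, one_mul]

/-- **The map-assisted Metropolis graph swap with `A`-preserving maps preserves the sector count in mean.** [ours] -/
theorem graphSwap_sectorCount_eq (hm : 1 ≤ m) (he : ∀ r, (e r).1 ≠ (e r).2) (hμ : ∀ k x, 0 < μ k x)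
    (hφA : ∀ r u, φ r u ∈ A ↔ u ∈ A) (y : Fin (K + 1) → S) :
    ∑ z, ptGraphSwap μ e φ y z * (∑ k, (if z k ∈ A then (1 : ℝ) else 0)) = ∑ k, (if y k ∈ A then (1 : ℝ) else 0) := by
  have hmpos : (0 : ℝ) < m := Nat.cast_pos.mpr (by omega)
  simp_rw [ptGraphSwap_eq_avg_entryKernel (φ := φ) hm he hμ, Finset.sum_mul]
  rw [Finset.sum_comm]
  simp_rw [mul_assoc, ← Finset.mul_sum]
  rw [Finset.sum_congr rfl fun r _ => by rw [entrySwap_sectorCount_eq hμ (φ r) (hφA r) (he r) y], sum_const,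
    card_univ, Fintype.card_fin, nsmul_eq_mul]
  field_simp

/-- **A product update costs at most one in mean:** `Σ_z Π_w^M(y,z)·N_A(z) ≥ N_A(y) − 1`. [ours] -/
theorem prodKernel_sectorCount_ge (hM : ∀ k, IsRowStochastic (M k)) (hw0 : ∀ k, 0 ≤ w k) (hw1 : ∑ k, w k = 1)
    (y : Fin (K + 1) → S) :
    (∑ k, (if y k ∈ A then (1 : ℝ) else 0)) - 1
      ≤ ∑ z, prodKernel w M y z * (∑ k, (if z k ∈ A then (1 : ℝ) else 0)) := by
  unfold prodKernel
  simp_rw [Finset.sum_mul]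
  rw [Finset.sum_comm]
  simp_rw [mul_assoc, ← Finset.mul_sum, sum_coordKernel_mul]
  calc (∑ k, (if y k ∈ A then (1 : ℝ) else 0)) - 1 = ∑ j, w j * ((∑ k, (if y k ∈ A then (1 : ℝ) else 0)) - 1) := by
        rw [← Finset.sum_mul, hw1, one_mul]
    _ ≤ ∑ j, w j * ∑ v, M j (y j) v * ∑ k, (if update y j v k ∈ A then (1 : ℝ) else 0) := by
        refine Finset.sum_le_sum fun j _ => mul_le_mul_of_nonneg_left ?_ (hw0 j)
        calc (∑ k, (if y k ∈ A then (1 : ℝ) else 0)) - 1 = ∑ v, M j (y j) v * ((∑ k, (if y k ∈ A then (1 : ℝ) else 0)) - 1) := by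
              rw [← Finset.sum_mul, (hM j).2 (y j), one_mul]
          _ ≤ _ := Finset.sum_le_sum fun v _ => mul_le_mul_of_nonneg_left (sectorCount_update_ge y j v) ((hM j).1 _ _)

/-- **THE ONE-STEP DRIFT: `Σ_z P(y,z)·N_A(z) ≥ N_A(y) − (1−t)`** (`t ≤ 1`, `A`-preserving maps). [ours] -/
theorem scheme_sectorCount_ge (hm : 1 ≤ m) (he : ∀ r, (e r).1 ≠ (e r).2) (hμ : ∀ k x, 0 < μ k x)
    (hM : ∀ k, IsRowStochastic (M k)) (hw0 : ∀ k, 0 ≤ w k) (hw1 : ∑ k, w k = 1) (ht1 : t ≤ 1)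
    (hφA : ∀ r u, φ r u ∈ A ↔ u ∈ A) (y : Fin (K + 1) → S) :
    (∑ k, (if y k ∈ A then (1 : ℝ) else 0)) - (1 - t)
      ≤ ∑ z, (t * ptGraphSwap μ e φ y z + (1 - t) * prodKernel w M y z) * (∑ k, (if z k ∈ A then (1 : ℝ) else 0)) := by
  have hsplit : ∀ z : Fin (K + 1) → S,
      (t * ptGraphSwap μ e φ y z + (1 - t) * prodKernel w M y z) * (∑ k, (if z k ∈ A then (1 : ℝ) else 0))
        = t * (ptGraphSwap μ e φ y z * (∑ k, (if z k ∈ A then (1 : ℝ) else 0)))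
          + (1 - t) * (prodKernel w M y z * (∑ k, (if z k ∈ A then (1 : ℝ) else 0))) := fun z => by ring
  rw [Finset.sum_congr rfl fun z _ => hsplit z, Finset.sum_add_distrib, ← Finset.mul_sum, ← Finset.mul_sum,
    graphSwap_sectorCount_eq hm he hμ hφA y]
  have h := mul_le_mul_of_nonneg_left (prodKernel_sectorCount_ge (A := A) (M := M) hM hw0 hw1 y)
    (by linarith : (0 : ℝ) ≤ 1 - t)
  linarith

/-- **`E_x[N_A(X_n)] ≥ N_A(x) − n(1−t)`.** [ours] -/
theorem scheme_lawAt_sectorCount_ge (hm : 1 ≤ m) (he : ∀ r, (e r).1 ≠ (e r).2) (hμ : ∀ k x, 0 < μ k x)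
    (hM : ∀ k, IsRowStochastic (M k)) (hw0 : ∀ k, 0 ≤ w k) (hw1 : ∑ k, w k = 1) (ht0 : 0 ≤ t) (ht1 : t ≤ 1)
    (hφA : ∀ r u, φ r u ∈ A ↔ u ∈ A) (x : Fin (K + 1) → S) (n : ℕ) :
    (∑ k, (if x k ∈ A then (1 : ℝ) else 0)) - n * (1 - t)
      ≤ ∑ z, lawAt (fun y z : Fin (K + 1) → S => t * ptGraphSwap μ e φ y z + (1 - t) * prodKernel w M y z)
          (Pi.single x 1) n z * (∑ k, (if z k ∈ A then (1 : ℝ) else 0)) := by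
  have hP := weightedScheme_isRowStochastic (t := t) (w := w) (ptGraphSwap_isRowStochastic (e := e) (φ := φ) hμ)
    hM hw0 hw1 ht0 ht1
  induction n with
  | zero =>
    simp only [Nat.cast_zero, zero_mul, sub_zero, lawAt_zero]
    rw [Finset.sum_eq_single x (fun z _ hz => by rw [Pi.single_eq_of_ne hz, zero_mul])
      (fun h => absurd (mem_univ x) h), Pi.single_eq_same, one_mul]
  | succ n ih =>
    rw [lawAt_succ]
    have hnn : ∀ y, 0 ≤ lawAt (fun y z : Fin (K + 1) → S => t * ptGraphSwap μ e φ y z + (1 - t) * prodKernel w M y z)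
        (Pi.single x 1) n y := fun y => lawAt_nonneg hP (fun a => by
      by_cases h : a = x
      · subst h; rw [Pi.single_eq_same]; norm_num
      · rw [Pi.single_eq_of_ne h]) n y
    have hmass : ∑ y, lawAt (fun y z : Fin (K + 1) → S => t * ptGraphSwap μ e φ y z + (1 - t) * prodKernel w M y z)
        (Pi.single x 1) n y = 1 := by
      rw [sum_lawAt hP, Finset.sum_pi_single', if_pos (mem_univ _)]
    have hswap : ∑ z, stepLaw (fun y z : Fin (K + 1) → S => t * ptGraphSwap μ e φ y z + (1 - t) * prodKernel w M y z)
          (lawAt (fun y z : Fin (K + 1) → S => t * ptGraphSwap μ e φ y z + (1 - t) * prodKernel w M y z)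
            (Pi.single x 1) n) z * (∑ k, (if z k ∈ A then (1 : ℝ) else 0))
        = ∑ y, lawAt (fun y z : Fin (K + 1) → S => t * ptGraphSwap μ e φ y z + (1 - t) * prodKernel w M y z)
            (Pi.single x 1) n y
          * ∑ z, (t * ptGraphSwap μ e φ y z + (1 - t) * prodKernel w M y z) * (∑ k, (if z k ∈ A then (1 : ℝ) else 0)) := by
      unfold stepLaw
      simp_rw [Finset.sum_mul, Finset.mul_sum, mul_assoc]
      rw [Finset.sum_comm]
    rw [hswap]
    calc (∑ k, (if x k ∈ A then (1 : ℝ) else 0)) - ((n + 1 : ℕ) : ℝ) * (1 - t)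
        = ((∑ k, (if x k ∈ A then (1 : ℝ) else 0)) - n * (1 - t)) - (1 - t) := by push_cast; ring
      _ ≤ (∑ y, lawAt (fun y z : Fin (K + 1) → S => t * ptGraphSwap μ e φ y z + (1 - t) * prodKernel w M y z)
            (Pi.single x 1) n y * (∑ k, (if y k ∈ A then (1 : ℝ) else 0))) - (1 - t) := by linarith [ih]
      _ = ∑ y, lawAt (fun y z : Fin (K + 1) → S => t * ptGraphSwap μ e φ y z + (1 - t) * prodKernel w M y z)
            (Pi.single x 1) n y * ((∑ k, (if y k ∈ A then (1 : ℝ) else 0)) - (1 - t)) := by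
          rw [Finset.sum_congr rfl fun y _ => (mul_sub _ _ _), Finset.sum_sub_distrib, ← Finset.sum_mul, hmass, one_mul]
      _ ≤ _ := Finset.sum_le_sum fun y _ =>
          mul_le_mul_of_nonneg_left (scheme_sectorCount_ge hm he hμ hM hw0 hw1 ht1 hφA y) (hnn y)

/-! ## §3 The separating event `{∃ k, z_k ∈ A}` -/

/-- **The union bound for the product law:** `π̃(∃ k, z_k ∈ A) ≤ Σ_k μ_k(A)`. [ours] -/
theorem tensorFun_mass_someInSector_le (hμ : ∀ k x, 0 < μ k x) (hμ1 : ∀ k, ∑ u, μ k u = 1) (A : Finset S) :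
    ∑ z ∈ univ.filter (fun z : Fin (K + 1) → S => ∃ k, z k ∈ A), tensorFun μ z ≤ ∑ k, ∑ u ∈ A, μ k u := by
  have hπ := tensorFun_pos hμ
  calc ∑ z ∈ univ.filter (fun z : Fin (K + 1) → S => ∃ k, z k ∈ A), tensorFun μ z
      = ∑ z, tensorFun μ z * (if ∃ k, z k ∈ A then (1 : ℝ) else 0) := by
        rw [Finset.sum_filter]; exact sum_congr rfl fun z _ => by split_ifs <;> simp
    _ ≤ ∑ z, tensorFun μ z * ∑ k, (if z k ∈ A then (1 : ℝ) else 0) := by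
        refine sum_le_sum fun z _ => mul_le_mul_of_nonneg_left ?_ (hπ z).le
        split_ifs with h
        · obtain ⟨k, hzk⟩ := h
          exact le_trans (by rw [if_pos hzk])
            (Finset.single_le_sum (f := fun k => if z k ∈ A then (1 : ℝ) else 0)
              (fun k _ => by split_ifs <;> norm_num) (mem_univ k))
        · exact sum_nonneg fun k _ => by split_ifs <;> norm_num
    _ = ∑ k, ∑ z, tensorFun μ z * (if z k ∈ A then (1 : ℝ) else 0) := by
        simp_rw [mul_sum]; rw [sum_comm]
    _ = ∑ k, ∑ u ∈ A, μ k u := by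
        refine sum_congr rfl fun k _ => ?_
        rw [← tensorFun_mass_levelSector (μ := μ) hμ1 k A, Finset.sum_filter]
        exact sum_congr rfl fun z _ => by split_ifs <;> simp

/-- **THE SECTOR REFRESH-BUDGET DISTANCE FLOOR:** `A`-preserving maps, a start `x` with every `x_k ∈ A`:
**`d(n) ≥ 1 − n(1−t)/(K+1) − Σ_k μ_k(A)`.** [ours] -/
theorem sectorBudget_worstTvDist_ge (hm : 1 ≤ m) (he : ∀ r, (e r).1 ≠ (e r).2) (hμ : ∀ k x, 0 < μ k x)
    (hμ1 : ∀ k, ∑ u, μ k u = 1) (hM : ∀ k, IsRowStochastic (M k)) (hw0 : ∀ k, 0 ≤ w k) (hw1 : ∑ k, w k = 1)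
    (ht0 : 0 ≤ t) (ht1 : t ≤ 1) (hφA : ∀ r u, φ r u ∈ A ↔ u ∈ A) (x : Fin (K + 1) → S) (hx : ∀ k, x k ∈ A) (n : ℕ) :
    1 - n * (1 - t) / (K + 1) - ∑ k, ∑ u ∈ A, μ k u
      ≤ worstTvDist (fun y z : Fin (K + 1) → S => t * ptGraphSwap μ e φ y z + (1 - t) * prodKernel w M y z)
          (tensorFun μ) n := by
  set L := lawAt (fun y z : Fin (K + 1) → S => t * ptGraphSwap μ e φ y z + (1 - t) * prodKernel w M y z)
      (Pi.single x 1) n with hL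
  have hP := weightedScheme_isRowStochastic (t := t) (w := w) (ptGraphSwap_isRowStochastic (e := e) (φ := φ) hμ)
    hM hw0 hw1 ht0 ht1
  have hnn : ∀ z, 0 ≤ L z := fun z => lawAt_nonneg hP (fun a => by
    by_cases h : a = x
    · subst h; rw [Pi.single_eq_same]; norm_num
    · rw [Pi.single_eq_of_ne h]) n z
  have hK : (0 : ℝ) < K + 1 := by positivity
  have hcount := scheme_lawAt_sectorCount_ge (A := A) (e := e) (M := M) (w := w) hm he hμ hM hw0 hw1 ht0 ht1 hφA x n
  have hxN : ∑ k : Fin (K + 1), (if x k ∈ A then (1 : ℝ) else 0) = K + 1 := by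
    rw [Finset.sum_congr rfl fun k _ => if_pos (hx k)]
    simp
  rw [hxN] at hcount
  -- `N_A(z) ≤ (K+1)·𝟙{∃ k, z_k ∈ A}`
  have hNle : ∀ z : Fin (K + 1) → S, (∑ k, (if z k ∈ A then (1 : ℝ) else 0))
      ≤ (K + 1) * (if (∃ k, z k ∈ A) then (1 : ℝ) else 0) := by
    intro z
    by_cases hA : ∃ k, z k ∈ A
    · rw [if_pos hA, mul_one]
      calc ∑ k, (if z k ∈ A then (1 : ℝ) else 0) ≤ ∑ _k : Fin (K + 1), (1 : ℝ) :=
            Finset.sum_le_sum fun k _ => by split_ifs <;> norm_num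
        _ = K + 1 := by simp
    · rw [if_neg hA, mul_zero]
      refine le_of_eq (Finset.sum_eq_zero fun k _ => ?_)
      rw [if_neg]
      exact fun hk => hA ⟨k, hk⟩
  have hev : 1 - n * (1 - t) / (K + 1) ≤ ∑ z ∈ univ.filter (fun z : Fin (K + 1) → S => ∃ k, z k ∈ A), L z := by
    have hsumle : ∑ z, L z * (∑ k, (if z k ∈ A then (1 : ℝ) else 0))
        ≤ (K + 1) * ∑ z ∈ univ.filter (fun z : Fin (K + 1) → S => ∃ k, z k ∈ A), L z := by
      rw [Finset.sum_filter, Finset.mul_sum]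
      refine Finset.sum_le_sum fun z _ => ?_
      calc L z * (∑ k, (if z k ∈ A then (1 : ℝ) else 0)) ≤ L z * ((K + 1) * (if (∃ k, z k ∈ A) then (1 : ℝ) else 0)) :=
            mul_le_mul_of_nonneg_left (hNle z) (hnn z)
        _ = (K + 1) * (if (∃ k, z k ∈ A) then L z else 0) := by split_ifs <;> ring
    rw [sub_le_iff_le_add, ← sub_le_iff_le_add', le_div_iff₀ hK]
    have := hcount.trans hsumle
    nlinarith
  have hmass : ∑ z, L z = ∑ z, tensorFun μ z := by
    rw [hL, sum_lawAt hP, Finset.sum_pi_single', if_pos (mem_univ _), sum_tensorFun_eq_one μ hμ1]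
  have htv := sub_sum_le_tvDist hmass (univ.filter (fun z : Fin (K + 1) → S => ∃ k, z k ∈ A))
  have hw := tvDist_single_le_worstTvDist (fun y z : Fin (K + 1) → S => t * ptGraphSwap μ e φ y z + (1 - t) * prodKernel w M y z)
    (tensorFun μ) n x
  have hπA := tensorFun_mass_someInSector_le (K := K) hμ hμ1 A
  linarith

/-- **THE SECTOR REFRESH-BUDGET FLOOR:** `A`-preserving maps, any swap list, any allocation, `μ_k`-reversible updates,
`0 ≤ t < 1`, a start with every replica in `A`, the scheme `ε`-close at some time:
**`t_mix(ε) ≥ (K+1)(1 − ε − Σ_k μ_k(A))/(1−t)`.** [ours] -/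
theorem sectorBudget_mixingTime_ge (hm : 1 ≤ m) (he : ∀ r, (e r).1 ≠ (e r).2) (hμ : ∀ k x, 0 < μ k x)
    (hμ1 : ∀ k, ∑ u, μ k u = 1) (hM : ∀ k, IsRowStochastic (M k)) (hMrev : ∀ k, DetailedBalance (μ k) (M k))
    (hw0 : ∀ k, 0 ≤ w k) (hw1 : ∑ k, w k = 1) (ht0 : 0 ≤ t) (ht1 : t < 1) (hφA : ∀ r u, φ r u ∈ A ↔ u ∈ A)
    (x : Fin (K + 1) → S) (hx : ∀ k, x k ∈ A) {ε : ℝ}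
    (hmix : ∃ t₀, worstTvDist (fun y z : Fin (K + 1) → S => t * ptGraphSwap μ e φ y z + (1 - t) * prodKernel w M y z)
      (tensorFun μ) t₀ ≤ ε) :
    ((K : ℝ) + 1) * (1 - ε - ∑ k, ∑ u ∈ A, μ k u) / (1 - t)
      ≤ (mixingTime (fun y z : Fin (K + 1) → S => t * ptGraphSwap μ e φ y z + (1 - t) * prodKernel w M y z)
          (tensorFun μ) ε : ℝ) := by
  set n := mixingTime (fun y z : Fin (K + 1) → S => t * ptGraphSwap μ e φ y z + (1 - t) * prodKernel w M y z)
    (tensorFun μ) ε with hn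
  have hP := weightedScheme_isRowStochastic (t := t) (w := w) (ptGraphSwap_isRowStochastic (e := e) (φ := φ) hμ)
    hM hw0 hw1 ht0 ht1.le
  have hst := (weightedScheme_detailedBalance (w := w) (ptGraphSwap_detailedBalance (e := e) (φ := φ) hμ) hMrev t).isStationary
    hP.2
  obtain ⟨t₀, ht₀⟩ := hmix
  have hd : worstTvDist (fun y z : Fin (K + 1) → S => t * ptGraphSwap μ e φ y z + (1 - t) * prodKernel w M y z)
      (tensorFun μ) n ≤ ε := worstTvDist_le_of_mixingTime_le hP hst ht₀ le_rfl
  have hfloor := sectorBudget_worstTvDist_ge (A := A) (e := e) (M := M) (w := w) hm he hμ hμ1 hM hw0 hw1 ht0 ht1.le hφA x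
    hx n
  have h1t : 0 < 1 - t := by linarith
  have hK : (0 : ℝ) < K + 1 := by positivity
  rw [div_le_iff₀ h1t]
  have h3 : 1 - (n : ℝ) * (1 - t) / (K + 1) - ∑ k, ∑ u ∈ A, μ k u ≤ ε := hfloor.trans hd
  rw [sub_sub, sub_le_iff_le_add] at h3
  have h4 : ((K : ℝ) + 1) * (1 - ε - ∑ k, ∑ u ∈ A, μ k u) ≤ (n : ℝ) * (1 - t) := by
    have := mul_le_mul_of_nonneg_left h3 hK.le
    rw [mul_add, mul_add, mul_div_cancel₀ _ hK.ne'] at this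
    linarith
  linarith

end Sector

end Summit.Ventures.LatticeQCDFlow.Scaling

end
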